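import Literature.NumberTheory.Automorphic.LanglandsTetrahedral
import Literature.NumberTheory.GaloisRepresentations.AbsGaloisGroup
import HarnessLib

/-!
# Continuity of a Galois action descends along restriction: `Γ_K`-continuous ⟹ `Γ_ℚ`-continuous (theorems only)

Ideator bsd-idea-11 (lens `nearmiss`), generation 16 — tree-ready crux workfile for crux 5 `MazurMCOnX1RankZero`
(stmt-BirchSwinnertonDyer-19035), road B, memo §11.3: step 0 of the reduction of the residual `GL(1)` input [P1]-cont to
Ferrero–Washington. The Cont statements (`ResidualGL1FinitenessOddCont`, `GL1InputUnramifiedCont`, `GL1InputSplitPrimeCont`)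
assume only that the RESTRICTED `Γ_K`-action on `M` is continuous; the construction of the abelian field `F' = K·ℚ(χ)` needs the
`Γ_ℚ`-action continuous (then `ker χ` is open and `ℚ(χ)/ℚ` is finite). This file proves the upgrade:
`continuous_smul_of_continuous_restrict` — if `σ • m = res σ • m` and every orbit map of `Γ_K` is continuous then every orbit
map of `Γ_F` is continuous (`F ⊆ K` number fields; discrete `M`). Mechanism (`continuous_smul_of_isOpenEmbedding`, any groups):
`res : Γ_K → Γ_F` is a continuous injection of a compact group into a Hausdorff group with OPEN image
(`Automorphic.isOpen_range_absGaloisRestrict_and_index`), hence an open embedding; the `Γ_F`-stabiliser of `m` contains the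
image of the open `Γ_K`-stabiliser, a neighbourhood of `1`, so it is an open subgroup, and orbit maps into a discrete space
with open stabilisers are continuous. Publish-only (W-71); sorry-free; no named fact, definition or instance. NO summit
statement, crux or stub is proved here. [cite: NeukirchANT1999, Ch. IV §1] [folklore]
-/

noncomputable section

open scoped Classical

open Field Topology

universe u v w

namespace Literature.NumberTheory.GaloisRepresentations

section Generic

variable {G : Type u} {G' : Type v} [Group G] [Group G'] [TopologicalSpace G] [TopologicalSpace G']
  {M : Type w} [MulAction G M] [TopologicalSpace M] [DiscreteTopology M]

/-- An orbit map `σ ↦ σ • m` into a DISCRETE space is continuous as soon as the stabiliser of `m` is open. [folklore] -/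
theorem continuous_smul_of_isOpen_stabilizer [IsTopologicalGroup G] (m : M) (h : IsOpen ((MulAction.stabilizer G m : Subgroup G) : Set G)) :
    Continuous fun σ : G ↦ σ • m := by
  rw [continuous_discrete_rng]
  intro b
  by_cases hb : ∃ σ₀ : G, σ₀ • m = b
  · obtain ⟨σ₀, rfl⟩ := hb
    have hset : (fun σ : G ↦ σ • m) ⁻¹' {σ₀ • m} = (fun σ : G ↦ σ₀⁻¹ * σ) ⁻¹' (MulAction.stabilizer G m : Set G) := by
      ext σ
      simp only [Set.mem_preimage, Set.mem_singleton_iff, SetLike.mem_coe, MulAction.mem_stabilizer_iff, mul_smul,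
        inv_smul_eq_iff]
    rw [hset]
    exact h.preimage (continuous_const.mul continuous_id)
  · have hset : (fun σ : G ↦ σ • m) ⁻¹' {b} = ∅ := by
      ext σ
      simp only [Set.mem_preimage, Set.mem_singleton_iff, Set.mem_empty_iff_false, iff_false]
      exact fun hσ ↦ hb ⟨σ, hσ⟩
    rw [hset]
    exact isOpen_empty

/-- Conversely to nothing: the stabiliser of `m` is open when the orbit map is continuous (discrete `M`). [folklore] -/
theorem isOpen_stabilizer_of_continuous_smul (m : M) (h : Continuous fun σ : G ↦ σ • m) :
    IsOpen ((MulAction.stabilizer G m : Subgroup G) : Set G) := by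
  have : ((MulAction.stabilizer G m : Subgroup G) : Set G) = (fun σ : G ↦ σ • m) ⁻¹' {m} := by
    ext σ; simp
  rw [this]
  exact (isOpen_discrete {m}).preimage h

/-- **Continuity of an action descends along an open embedding of groups.** Let `f : G' → G` be a continuous injective
homomorphism with open image from a compact group to a Hausdorff topological group, `G` acting on a discrete `M` and `G'`
through `f`. If every `G'`-orbit map is continuous then every `G`-orbit map is continuous: the `G`-stabiliser of `m`
contains `f(Stab_{G'}(m))`, which is open in `G` (`f` is an open embedding) and contains `1`, so it is an open subgroup.
[cite: NeukirchANT1999, Ch. IV §1] [folklore] -/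
theorem continuous_smul_of_isOpenEmbedding [IsTopologicalGroup G] [CompactSpace G'] [T2Space G] [MulAction G' M] (f : G' →* G)
    (hf : Continuous f) (hinj : Function.Injective f) (hopen : IsOpen (Set.range f))
    (hprov : ∀ (σ : G') (m : M), σ • m = f σ • m) (hcont : ∀ m : M, Continuous fun σ : G' ↦ σ • m) (m : M) :
    Continuous fun τ : G ↦ τ • m := by
  refine continuous_smul_of_isOpen_stabilizer m ?_
  have hemb : IsOpenEmbedding f :=
    { toIsEmbedding := (hf.isClosedEmbedding hinj).isEmbedding
      isOpen_range := hopen }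
  -- the image of the (open) `G'`-stabiliser is an open subset of the `G`-stabiliser containing `1`
  have hS' : IsOpen ((MulAction.stabilizer G' m : Subgroup G') : Set G') :=
    isOpen_stabilizer_of_continuous_smul m (hcont m)
  have himg : IsOpen (f '' ((MulAction.stabilizer G' m : Subgroup G') : Set G')) := hemb.isOpenMap _ hS'
  have hsub : f '' ((MulAction.stabilizer G' m : Subgroup G') : Set G') ⊆ (MulAction.stabilizer G m : Set G) := by
    rintro _ ⟨σ, hσ, rfl⟩
    rw [SetLike.mem_coe, MulAction.mem_stabilizer_iff] at hσ ⊢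
    rw [← hprov, hσ]
  have h1 : (1 : G) ∈ f '' ((MulAction.stabilizer G' m : Subgroup G') : Set G') := ⟨1, by simp, map_one f⟩
  exact Subgroup.isOpen_of_mem_nhds _ (Filter.mem_of_superset (himg.mem_nhds h1) hsub)

end Generic

section Galois

variable (F : Type) (K : Type) [Field F] [NumberField F] [Field K] [NumberField K] [Algebra F K]

/-- **`Γ_K`-continuity ⟹ `Γ_F`-continuity for a restricted Galois action** (`F ⊆ K` number fields): if a `Γ_F`-action on a
discrete `M` restricts along `res : Γ_K → Γ_F` (`σ • m = res σ • m`) to a `Γ_K`-action all of whose orbit maps are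
continuous, then all `Γ_F`-orbit maps are continuous — `res` is a continuous injection (`absGaloisRestrict_injective`) of
the compact `Γ_K` into the Hausdorff `Γ_F` with open image of index `[K : F]`
(`Automorphic.isOpen_range_absGaloisRestrict_and_index`). Road-B use: `F = ℚ`, `K` imaginary quadratic, `M` of order `p`
— the continuity antecedent of `ResidualGL1FinitenessOddCont` gives a CONTINUOUS character `χ : Γ_ℚ → Aut M`, so `ℚ(χ)` is a
finite abelian extension. [cite: NeukirchANT1999, Ch. IV §1] [folklore] -/
theorem continuous_smul_of_continuous_restrict {M : Type w} [TopologicalSpace M] [DiscreteTopology M]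
    [MulAction (absoluteGaloisGroup F) M] [MulAction (absoluteGaloisGroup K) M]
    (hprov : ∀ (σ : absoluteGaloisGroup K) (m : M), σ • m = absGaloisRestrict F K σ • m)
    (hcont : ∀ m : M, Continuous fun σ : absoluteGaloisGroup K ↦ σ • m) (m : M) :
    Continuous fun τ : absoluteGaloisGroup F ↦ τ • m := by
  haveI : FiniteDimensional F K := Module.Finite.of_restrictScalars_finite ℚ F K
  have hopen : IsOpen (Set.range (absGaloisRestrict F K)) := by
    have h := (Automorphic.isOpen_range_absGaloisRestrict_and_index F K).1
    simpa [MonoidHom.coe_range] using h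
  exact continuous_smul_of_isOpenEmbedding (absGaloisRestrict F K).toMonoidHom (absGaloisRestrict F K).continuous_toFun
    (absGaloisRestrict_injective F K) hopen hprov hcont m

end Galois

end Literature.NumberTheory.GaloisRepresentations

end
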